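import Literature.NumberTheory.LFunctions.VinogradovMeanValueBound
import HarnessLib

/-!
# Ford's Lemma 6.6 (single-prime step with the SAME number of variables), two-sided second class

Topic `Literature/NumberTheory/LFunctions`.  Everything in this file is PROVED; no definition and
no named fact is introduced.

K. Ford, *Vinogradov's integral and bounds for the Riemann zeta function*, Proc. LMS 85 (2002),
Lemma 6.6: for a prime `p` (there `P^{1/k} ≤ p ≤ 2P^{1/k}`),
`J_{s+k,k}(P) ≤ max[(ep)^{2k-2}(k-1)^{2s+2} J_{s+k,k}(P/p), (32/k!)(s+k)^{2k} p^{2s+k(k-1)/2} P^k J_{s,k}(P/p)]`: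
the solutions are split according to whether the digit patterns `(X_i mod p)`, `(Y_i mod p)` take
fewer than `k` values ("second class") or not; the point — as opposed to Ivić's Lemma 6.2
(`VMV.lemma62`, which drops `k` variables in BOTH classes) — is that the second class is bounded by
`J` with the SAME number of variables on the range `P/p`, so that the iteration (Lemma 6.7) is an
induction on `P` costing no constant in that branch.

On top of the tree's set-up (`VinogradovMeanValueStepA/FirstClass/Bound.lean`: the box
`[1, pP₁]`, digits, `VMV.Sol`, `VMV.degPat`, `VMV.firstClassProd`, Linnik's lemma) we prove:

* `FordVK.card_sol_deg2_le` — the **two-sided second class**: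
  `#{(X,Y) ∈ Sol : X and Y degenerate} ≤ #degPat² · J_{K,n}([0,P₁))` (Cauchy–Schwarz over the
  patterns and AM–GM, as in `VMV.card_sol_deg_le` but with BOTH sides restricted — Ford's `|ℬ|²`);
* `FordVK.J_IQ_le_two_classes` — `J_{K,n}([1,pP₁]) ≤ 2 #{both degenerate} + 2 #{both nondegenerate}`
  (`|f_deg + f_nd|² ≤ 2|f_deg|² + 2|f_nd|²` on the torus);
* `FordVK.ford_lemma66` — for `n ≥ 1`, `s ≥ 1`, a prime `p > n` and `pP₁ ≤ m pⁿ`: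
  `J_{n+s,n}([1,pP₁]) ≤ 2 (p^{n-1} n^{n+s})² J_{n+s,n}([1,P₁]) + 2 C(n+s,n)² p^{2s} (pP₁)ⁿ n! mⁿ p^{n(n-1)/2} J_{s,n}([1,P₁])`
  (Ford's shape with the tree's constants: `#degPat ≤ p^{n-1}nᴷ` for `½(ep)^{n-1}(n-1)^{s+1}`,
  positions `C(n+s,n)²` — `FordVK.card_Sol_nondeg_le_choose` — for `16·C(n+s,n)²`, Linnik with `mⁿ`),
  and `FordVK.ford_lemma66_Icc`, the
  same for `J_{n+s,n}([1,P])`, `P ≤ pP₁`.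

## References

* K. Ford, *Vinogradov's integral and bounds for the Riemann zeta function*, Proc. London Math.
  Soc. (3) 85 (2002), 565–633; arXiv:1910.08209. Lemma 6.6 and its proof. [Ford2002]
* A. Ivić, *The Riemann Zeta-Function* (1985), §6.2, proof of Lemma 6.2 (via the tree's
  `VinogradovMeanValue*.lean`). [Ivic1985]
-/

noncomputable section

open Finset MeasureTheory Complex
open scoped Real ComplexConjugate

namespace Literature.NumberTheory.LFunctions
namespace FordVK

open VMV

/-! ### The two-sided second class -/

/-- **Two-sided second class** (Ford's `S₂ ≤ 2|ℬ|² J(P/p+1)` in the tree's set-up): the number of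
solutions `(X, Y)` of `s(X) = s(Y)` in `[1, pP₁]^k × [1, pP₁]^k` whose digit patterns are BOTH
degenerate is at most `#degPat² · J_{k,n}([0, P₁))`. [cite: Ford2002, proof of Lemma 6.6 (the case
`S₂ ≥ S₁`)] -/
theorem card_sol_deg2_le {n k p P₁ : ℕ} (hp : 0 < p) (hk : 1 ≤ k) :
    (((tuples k (IQ p P₁) ×ˢ tuples k (IQ p P₁)).filter (fun XY => psv n XY.1 = psv n XY.2 + 0 ∧
        IsDegPat n (fun i => digit p (XY.1 i)) ∧ IsDegPat n (fun i => digit p (XY.2 i)))).card : ℝ)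
      ≤ ((degPat n k p).card : ℝ) ^ 2 * J n k (Yset P₁) := by
  classical
  set Deg := (tuples k (IQ p P₁)).filter (fun X => IsDegPat n (fun i => digit p (X i))) with hDeg
  -- the count as an integral
  have hcount : ((((tuples k (IQ p P₁) ×ˢ tuples k (IQ p P₁)).filter (fun XY =>
      psv n XY.1 = psv n XY.2 + 0 ∧ IsDegPat n (fun i => digit p (XY.1 i)) ∧
        IsDegPat n (fun i => digit p (XY.2 i)))).card : ℝ) : ℂ)
      = ∫ α in box n, tp Deg (psv n) α * conj (tp Deg (psv n) α) := by
    rw [integral_tp_mul_conj_tp]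
    norm_cast
    congr 1
    ext XY
    simp only [hDeg, mem_filter, mem_product, add_zero]
    tauto
  -- pointwise bound of the integrand
  set a : ℤ → (Fin n → ℝ) → ℝ := fun x α => ‖Sx n p P₁ x α‖ with ha
  have ha0 : ∀ x α, 0 ≤ a x α := fun x α => norm_nonneg _
  set G : (Fin n → ℝ) → ℝ := fun α => ∑ x ∈ degPat n k p, ∑ x' ∈ degPat n k p,
      ((∑ i, a (x i) α ^ (2 * k)) + ∑ i, a (x' i) α ^ (2 * k)) / (2 * k) with hG
  have hpt : ∀ α, ‖tp Deg (psv n) α * conj (tp Deg (psv n) α)‖ ≤ G α := by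
    intro α
    rw [norm_mul, Complex.norm_conj, hDeg, tp_deg_eq hp]
    have h1 : ‖∑ x ∈ degPat n k p, ∏ i, Sx n p P₁ (x i) α‖ ≤ ∑ x ∈ degPat n k p, ∏ i, a (x i) α := by
      refine (norm_sum_le _ _).trans (sum_le_sum fun x _ => ?_)
      rw [norm_prod]
    calc ‖∑ x ∈ degPat n k p, ∏ i, Sx n p P₁ (x i) α‖ * ‖∑ x ∈ degPat n k p, ∏ i, Sx n p P₁ (x i) α‖
        ≤ (∑ x ∈ degPat n k p, ∏ i, a (x i) α) * ∑ x' ∈ degPat n k p, ∏ i, a (x' i) α :=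
          mul_le_mul h1 h1 (norm_nonneg _) (sum_nonneg fun _ _ => prod_nonneg fun _ _ => ha0 _ _)
      _ = ∑ x ∈ degPat n k p, ∑ x' ∈ degPat n k p, (∏ i, a (x i) α) * ∏ i, a (x' i) α := by
          rw [sum_mul_sum]
      _ ≤ G α := sum_le_sum fun x _ => sum_le_sum fun x' _ =>
          prod_mul_prod_le_sum_pow hk _ _ (fun i => ha0 _ _) (fun i => ha0 _ _)
  -- integrate
  have hGint : ∫ α in box n, G α = ((degPat n k p).card : ℝ) ^ 2 * J n k (Yset P₁) := by
    have hI : ∀ x : ℤ, ∫ α in box n, a x α ^ (2 * k) = (J n k (Yset P₁) : ℝ) :=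
      fun x => integral_norm_Sx_pow hp k x
    have hint : ∀ x : ℤ, Integrable (fun α => a x α ^ (2 * k)) (volume.restrict (box n)) :=
      fun x => integrableOn_box_of_continuous_real ((continuous_Sx n p P₁ x).norm.pow _)
    have hterm : ∀ (x x' : Fin k → ℤ), ∫ α in box n,
        ((∑ i, a (x i) α ^ (2 * k)) + ∑ i, a (x' i) α ^ (2 * k)) / (2 * k) = (J n k (Yset P₁) : ℝ) := by
      intro x x'
      rw [integral_div, integral_add (integrable_finsetSum _ fun i _ => hint _)
        (integrable_finsetSum _ fun i _ => hint _), integral_finsetSum _ (fun i _ => hint _),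
        integral_finsetSum _ (fun i _ => hint _)]
      simp_rw [hI]
      simp only [sum_const, card_univ, Fintype.card_fin, nsmul_eq_mul]
      have : (k : ℝ) ≠ 0 := by exact_mod_cast (show k ≠ 0 by omega)
      field_simp
      ring
    have hint2 : ∀ (x x' : Fin k → ℤ), Integrable (fun α =>
        ((∑ i, a (x i) α ^ (2 * k)) + ∑ i, a (x' i) α ^ (2 * k)) / (2 * k)) (volume.restrict (box n)) :=
      fun x x' => ((integrable_finsetSum _ fun i _ => hint (x i)).add
        (integrable_finsetSum _ fun i _ => hint (x' i))).div_const _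
    rw [hG]
    rw [integral_finsetSum _ (fun x _ => integrable_finsetSum _ fun x' _ => hint2 x x')]
    simp_rw [integral_finsetSum _ (fun x' _ => hint2 _ x'), hterm]
    rw [sum_const, sum_const, nsmul_eq_mul, nsmul_eq_mul]
    ring
  -- assemble
  have hGi : Integrable G (volume.restrict (box n)) := by
    refine integrableOn_box_of_continuous_real ?_
    unfold G
    refine continuous_finsetSum _ fun x _ => continuous_finsetSum _ fun x' _ => Continuous.div_const ?_ _
    exact (continuous_finsetSum _ fun i _ => ((continuous_Sx n p P₁ _).norm.pow _)).add
      (continuous_finsetSum _ fun i _ => ((continuous_Sx n p P₁ _).norm.pow _))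
  have key : ((((tuples k (IQ p P₁) ×ˢ tuples k (IQ p P₁)).filter (fun XY =>
      psv n XY.1 = psv n XY.2 + 0 ∧ IsDegPat n (fun i => digit p (XY.1 i)) ∧
        IsDegPat n (fun i => digit p (XY.2 i)))).card : ℝ)) ≤ ∫ α in box n, G α := by
    have h1 := congrArg norm hcount
    rw [Complex.norm_real, Real.norm_eq_abs, abs_of_nonneg (Nat.cast_nonneg _)] at h1
    rw [h1]
    refine (norm_integral_le_integral_norm _).trans ?_
    refine integral_mono_of_nonneg (Filter.Eventually.of_forall fun α => norm_nonneg _) hGi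
      (Filter.Eventually.of_forall hpt)
  rw [hGint] at key
  exact key

/-! ### `J ≤ 2·#{both degenerate} + 2·#{both nondegenerate}` -/

/-- **Splitting by the two patterns**: `J_{k,n}([1,pP₁]) ≤ 2 #{both degenerate} + 2 #{both nondegenerate}`
(on the torus `J = ∫|f_deg + f_nd|²` and `|a+b|² ≤ 2|a|² + 2|b|²`). [cite: Ford2002, proof of
Lemma 6.6 ("Clearly `J ≤ 2 max(S₁,S₂)`", in a symmetric form)] -/
theorem J_IQ_le_two_classes {n k p P₁ : ℕ} :
    (J n k (IQ p P₁) : ℝ)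
      ≤ 2 * ((((tuples k (IQ p P₁) ×ˢ tuples k (IQ p P₁)).filter (fun XY => psv n XY.1 = psv n XY.2 + 0 ∧
          IsDegPat n (fun i => digit p (XY.1 i)) ∧ IsDegPat n (fun i => digit p (XY.2 i)))).card : ℕ) : ℝ)
        + 2 * ((((Sol n k p P₁).filter (fun XY => ¬ IsDegPat n (fun i => digit p (XY.1 i)) ∧
          ¬ IsDegPat n (fun i => digit p (XY.2 i)))).card : ℕ) : ℝ) := by
  classical
  set All := tuples k (IQ p P₁) with hAll
  set Deg := All.filter (fun X => IsDegPat n (fun i => digit p (X i))) with hDeg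
  set Nd := All.filter (fun X => ¬ IsDegPat n (fun i => digit p (X i))) with hNd
  -- the three counts as integrals of squares
  have hJ : (J n k (IQ p P₁) : ℝ) = ∫ α in box n, ‖tp All (psv n) α‖ ^ 2 := by
    rw [integral_norm_sq_tp]
    unfold J Jc
    rw [hAll]
    norm_cast
    congr 1
    refine filter_congr fun XY _ => ?_
    rw [add_zero]
  have hD : ((((tuples k (IQ p P₁) ×ˢ tuples k (IQ p P₁)).filter (fun XY => psv n XY.1 = psv n XY.2 + 0 ∧
      IsDegPat n (fun i => digit p (XY.1 i)) ∧ IsDegPat n (fun i => digit p (XY.2 i)))).card : ℝ))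
      = ∫ α in box n, ‖tp Deg (psv n) α‖ ^ 2 := by
    rw [integral_norm_sq_tp]
    norm_cast
    congr 1
    ext XY
    simp only [hDeg, hAll, mem_filter, mem_product, add_zero]
    tauto
  have hN : ((((Sol n k p P₁).filter (fun XY => ¬ IsDegPat n (fun i => digit p (XY.1 i)) ∧
      ¬ IsDegPat n (fun i => digit p (XY.2 i)))).card : ℝ))
      = ∫ α in box n, ‖tp Nd (psv n) α‖ ^ 2 := by
    rw [integral_norm_sq_tp]
    norm_cast
    congr 1
    ext XY
    simp only [hNd, hAll, Sol, mem_filter, mem_product, add_zero]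
    tauto
  -- `f_All = f_Deg + f_Nd`
  have hsplit : ∀ α, tp All (psv n) α = tp Deg (psv n) α + tp Nd (psv n) α := by
    intro α
    unfold tp
    rw [hDeg, hNd, ← Finset.sum_filter_add_sum_filter_not All (fun X => IsDegPat n (fun i => digit p (X i)))]
  have hpt : ∀ α, ‖tp All (psv n) α‖ ^ 2 ≤ 2 * ‖tp Deg (psv n) α‖ ^ 2 + 2 * ‖tp Nd (psv n) α‖ ^ 2 := by
    intro α
    rw [hsplit]
    have h := norm_add_le (tp Deg (psv n) α) (tp Nd (psv n) α)
    nlinarith [norm_nonneg (tp Deg (psv n) α + tp Nd (psv n) α), norm_nonneg (tp Deg (psv n) α),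
      norm_nonneg (tp Nd (psv n) α), sq_nonneg (‖tp Deg (psv n) α‖ - ‖tp Nd (psv n) α‖)]
  have hint : ∀ (s : Finset (Fin k → ℤ)), Integrable (fun α => ‖tp s (psv n) α‖ ^ 2) (volume.restrict (box n)) :=
    fun s => integrableOn_box_of_continuous_real ((continuous_tp _ _).norm.pow _)
  rw [hJ, hD, hN, ← integral_const_mul, ← integral_const_mul,
    ← integral_add ((hint Deg).const_mul _) ((hint Nd).const_mul _)]
  exact integral_mono_of_nonneg (Filter.Eventually.of_forall fun α => by positivity)
    (((hint Deg).const_mul _).add ((hint Nd).const_mul _)) (Filter.Eventually.of_forall hpt)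

/-! ### First class with positions counted by `n`-subsets (`C(n+s,n)²` in place of `(n+s)^{2n}`) -/

/-- A nondegenerate pattern has an `n`-SUBSET of positions, listed increasingly, carrying distinct
values. [folklore] -/
theorem exists_subset_orderEmb_injective {n k : ℕ} {x : Fin k → ℤ} (h : ¬ IsDegPat n x) :
    ∃ T : Finset (Fin k), ∃ hT : T.card = n,
      Function.Injective (fun i => x (T.orderEmbOfFin hT i)) := by
  classical
  obtain ⟨g, hg⟩ := exists_injective_comp_of_not_isDegPat h
  have hginj : Function.Injective g := fun a b hab => hg (by simp only [hab])
  refine ⟨univ.image g, by rw [card_image_of_injective _ hginj, card_univ, Fintype.card_fin], ?_⟩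
  intro i j hij
  set e := (univ.image g).orderEmbOfFin (by rw [card_image_of_injective _ hginj, card_univ, Fintype.card_fin])
  have hi : e i ∈ univ.image g := Finset.orderEmbOfFin_mem _ _ i
  have hj : e j ∈ univ.image g := Finset.orderEmbOfFin_mem _ _ j
  obtain ⟨a, -, ha⟩ := mem_image.1 hi
  obtain ⟨b, -, hb⟩ := mem_image.1 hj
  have hab : a = b := by
    apply hg
    simp only
    rw [ha, hb]
    exact hij
  apply e.injective
  rw [← ha, ← hb, hab]

/-- **First class, positions by subsets**: the solutions with both digit patterns nondegenerate
number at most `C(n+s,n)² J₁'` (Ford: "the positions of `x_{j_1},…,x_{j_k}` can be chosen in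
`C(k+s,k)` ways, and the same for `y`"). [cite: Ford2002, proof of Lemma 3.3 / Lemma 6.6
("`J₄(𝐡) ≤ C(k+s,k)² J₅(𝐡)`")] -/
theorem card_Sol_nondeg_le_choose {n s p P₁ : ℕ} :
    ((Sol n (n + s) p P₁).filter (fun XY => ¬ IsDegPat n (fun i => digit p (XY.1 i)) ∧
        ¬ IsDegPat n (fun i => digit p (XY.2 i)))).card ≤
      (Nat.choose (n + s) n) ^ 2 * firstClassProd n s p P₁ := by
  classical
  -- the increasing enumeration of an `n`-subset (junk outside `card = n`)
  set emb : Finset (Fin (n + s)) → (Fin n → Fin (n + s)) := fun T =>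
    if hT : T.card = n then (fun i => T.orderEmbOfFin hT i) else fun i => Fin.castAdd s i with hemb
  set Cl := fun TT : Finset (Fin (n + s)) × Finset (Fin (n + s)) =>
    (Sol n (n + s) p P₁).filter (fun XY => Function.Injective (fun i => digit p (XY.1 (emb TT.1 i))) ∧
        Function.Injective (fun i => digit p (XY.2 (emb TT.2 i)))) with hCl
  set Idx := (univ : Finset (Fin (n + s))).powersetCard n ×ˢ (univ : Finset (Fin (n + s))).powersetCard n
    with hIdx
  have hcover : ((Sol n (n + s) p P₁).filter (fun XY => ¬ IsDegPat n (fun i => digit p (XY.1 i)) ∧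
        ¬ IsDegPat n (fun i => digit p (XY.2 i)))) ⊆ Idx.biUnion Cl := by
    intro XY hXY
    rw [mem_filter] at hXY
    obtain ⟨T, hT, hTinj⟩ := exists_subset_orderEmb_injective hXY.2.1
    obtain ⟨T', hT', hT'inj⟩ := exists_subset_orderEmb_injective hXY.2.2
    rw [mem_biUnion]
    refine ⟨(T, T'), ?_, ?_⟩
    · rw [hIdx, mem_product, mem_powersetCard, mem_powersetCard]
      exact ⟨⟨subset_univ _, hT⟩, ⟨subset_univ _, hT'⟩⟩
    · rw [hCl, mem_filter]
      refine ⟨hXY.1, ?_, ?_⟩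
      · have : emb T = fun i => T.orderEmbOfFin hT i := by rw [hemb]; simp only [hT, dite_true]
        rw [this]; exact hTinj
      · have : emb T' = fun i => T'.orderEmbOfFin hT' i := by rw [hemb]; simp only [hT', dite_true]
        rw [this]; exact hT'inj
  calc _ ≤ (Idx.biUnion Cl).card := card_le_card hcover
    _ ≤ ∑ TT ∈ Idx, (Cl TT).card := card_biUnion_le
    _ ≤ ∑ _TT ∈ Idx, firstClassProd n s p P₁ :=
        sum_le_sum fun TT _ => card_Sol_positions_le (emb TT.1) (emb TT.2)
    _ = (Nat.choose (n + s) n) ^ 2 * firstClassProd n s p P₁ := by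
        rw [sum_const, smul_eq_mul, hIdx, card_product, card_powersetCard, card_univ, Fintype.card_fin]
        ring

/-! ### Lemma 6.6 -/

/-- **Ford's Lemma 6.6 (single-prime step keeping the number of variables), in the tree's
constants.** For `n ≥ 1`, `s ≥ 1`, a prime `p > n` and `pP₁ ≤ m pⁿ`,
`J_{n+s,n}([1,pP₁]) ≤ 2 (p^{n-1} n^{n+s})² J_{n+s,n}([1,P₁]) + 2 C(n+s,n)² p^{2s} (pP₁)ⁿ n! mⁿ p^{n(n-1)/2} J_{s,n}([1,P₁])`.
[cite: Ford2002, Lemma 6.6 (with `#ℬ ≤ p^{n-1} n^{n+s}`, positions `C(n+s,n)²`, and Linnik's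
lemma in the tree's form `VMV.linnik_lemma`)] -/
theorem ford_lemma66 {n s p P₁ m : ℕ} (hp : p.Prime) (hnp : n < p) (hn : 1 ≤ n) (hs : 1 ≤ s)
    (hm : p * P₁ ≤ m * p ^ n) :
    (J n (n + s) (IQ p P₁) : ℝ)
      ≤ 2 * ((p : ℝ) ^ (n - 1) * (n : ℝ) ^ (n + s)) ^ 2 * J n (n + s) (Finset.Icc (1 : ℤ) P₁)
        + 2 * (((n + s).choose n : ℕ) : ℝ) ^ 2 * ((p : ℝ) ^ (2 * s) * ((p * P₁ : ℕ) : ℝ) ^ n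
          * (Nat.factorial n * (m : ℝ) ^ n * (p : ℝ) ^ (n * (n - 1) / 2)))
          * J n s (Finset.Icc (1 : ℤ) P₁) := by
  have hk : 1 ≤ n + s := by omega
  have h1 := J_IQ_le_two_classes (n := n) (k := n + s) (p := p) (P₁ := P₁)
  have h2 := card_sol_deg2_le (n := n) (k := n + s) (P₁ := P₁) hp.pos hk
  have h3 : ((degPat n (n + s) p).card : ℝ) ≤ (p : ℝ) ^ (n - 1) * (n : ℝ) ^ (n + s) := by
    exact_mod_cast card_degPat_le (k := n + s) hn hnp.le
  have h4 : ((((Sol n (n + s) p P₁).filter (fun XY => ¬ IsDegPat n (fun i => digit p (XY.1 i)) ∧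
      ¬ IsDegPat n (fun i => digit p (XY.2 i)))).card : ℕ) : ℝ)
      ≤ (((n + s).choose n : ℕ) : ℝ) ^ 2 * firstClassProd n s p P₁ := by
    exact_mod_cast card_Sol_nondeg_le_choose (n := n) (s := s) (p := p) (P₁ := P₁)
  have h5 := firstClassProd_le hp hnp hs hm
  rw [J_Icc_eq_J_Yset, J_Icc_eq_J_Yset]
  have hJ0 : (0 : ℝ) ≤ J n (n + s) (Yset P₁) := Nat.cast_nonneg _
  have hJ0' : (0 : ℝ) ≤ J n s (Yset P₁) := Nat.cast_nonneg _
  calc (J n (n + s) (IQ p P₁) : ℝ) ≤ _ := h1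
    _ ≤ 2 * (((degPat n (n + s) p).card : ℝ) ^ 2 * J n (n + s) (Yset P₁))
        + 2 * ((((n + s).choose n : ℕ) : ℝ) ^ 2 * firstClassProd n s p P₁) := by
        gcongr
    _ ≤ 2 * (((p : ℝ) ^ (n - 1) * (n : ℝ) ^ (n + s)) ^ 2 * J n (n + s) (Yset P₁))
        + 2 * ((((n + s).choose n : ℕ) : ℝ) ^ 2 * ((p : ℝ) ^ (2 * s) * ((p * P₁ : ℕ) : ℝ) ^ n *
          (Nat.factorial n * (m : ℝ) ^ n * (p : ℝ) ^ (n * (n - 1) / 2)) * J n s (Yset P₁))) := by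
        gcongr
    _ = _ := by ring

/-- **Ford's Lemma 6.6 for `J_{n+s,n}([1,P])`**: if moreover `P ≤ pP₁` (e.g. `P₁ = ⌊P/p⌋ + 1`), then
`J_{n+s,n}([1,P])` satisfies the same bound. [cite: Ford2002, Lemma 6.6] -/
theorem ford_lemma66_Icc {n s p P₁ m P : ℕ} (hp : p.Prime) (hnp : n < p) (hn : 1 ≤ n) (hs : 1 ≤ s)
    (hm : p * P₁ ≤ m * p ^ n) (hP : P ≤ p * P₁) :
    (J n (n + s) (Finset.Icc (1 : ℤ) P) : ℝ)
      ≤ 2 * ((p : ℝ) ^ (n - 1) * (n : ℝ) ^ (n + s)) ^ 2 * J n (n + s) (Finset.Icc (1 : ℤ) P₁)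
        + 2 * (((n + s).choose n : ℕ) : ℝ) ^ 2 * ((p : ℝ) ^ (2 * s) * ((p * P₁ : ℕ) : ℝ) ^ n
          * (Nat.factorial n * (m : ℝ) ^ n * (p : ℝ) ^ (n * (n - 1) / 2)))
          * J n s (Finset.Icc (1 : ℤ) P₁) := by
  have hsub : Finset.Icc (1 : ℤ) P ⊆ IQ p P₁ := by
    intro x hx
    rw [Finset.mem_Icc] at hx
    unfold IQ
    rw [Finset.mem_Icc]
    exact ⟨hx.1, hx.2.trans (by exact_mod_cast hP)⟩
  have hmono : J n (n + s) (Finset.Icc (1 : ℤ) P) ≤ J n (n + s) (IQ p P₁) := Jc_mono n (n + s) hsub 0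
  exact le_trans (by exact_mod_cast hmono) (ford_lemma66 hp hnp hn hs hm)

end FordVK
end Literature.NumberTheory.LFunctions
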